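import Mathlib
import HarnessLib
import HarnessLib.Audit
import Summits.ValiantsHypothesis.Statement
import Literature.Computability.AlgebraicComplexity.RazExplicit
import Literature.Computability.AlgebraicComplexity.RazElusiveGeneralDischarge
import Literature.Computability.AlgebraicComplexity.ValiantConjectureProofs

/-!
Route: Elusive

CLOSED (superseded) 2026-08-16T05:54:03Z by planner-rbadge-ValiantsHypothesis-Elusive-e0ef0772-g3-0 — reason: superseded:route-ValiantsHypothesis-BinomialElusive — superseded by route-ValiantsHypothesis-BinomialElusive — note: route-repair g3 (badge) decision: CLOSE SUPERSEDED by route-ValiantsHypothesis-BinomialElusive. CENSUS. (1) NOT refuted: the digit-curve line (DigitCurveElusive stmt-8430, two-term carry-free power-sum exponents at order h=⌊log₂ m⌋, degree 2^{O(log³ m)}) survived 5 refuter passes (2026-08-15); engin. The file is kept as the record of this route; refuted decls are indexed as negative knowledge (`ledger negatives`).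

# Route Elusive — Raz's explicit (m−1,2)-elusive curve via the two-term B_h digit curve at
quasi-polynomial degree

It suffices to show X = ExplicitElusiveCurve — Raz's open problem in Raz's PROVED vocabulary
(Raz2010 §1 result 1 with
Prop. 1.2 / Def. 1.3; the implication X ⇒ per ∉ VP_ℂ is the tree theorem
`Raz2010_elusive_curve_holds ℂ`): there are
m : ℕ → ℕ with m(n) ≥ n^{ω(1)} and curves f_n : ℂ → ℂ^{m(n)} with polynomial coordinates of degree <
2^n whose
multilinearisation is poly(n)-definable (`IsPolyDefinableMap`), such that eventually no polynomial
map
Γ : ℂ^{m(n)−1} → ℂ^{m(n)} of degree ≤ 2 has image containing f_n(ℂ) ("f_n is (m−1,2)-elusive", Def.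
1.1 unfolded).
The route's BET is one concrete witness: the DIGIT CURVE F^{(h)}_m : x ↦ (x^{e(2i+1)} +
x^{e(2i+2)})_{i<m},
e(v) = Σ_{k≤h} v^k T^k, T = (2m+2)^{h+1}, at order h = ⌊log₂ m⌋ (crux DigitCurveElusive), re-indexed
m(n) = 2^{⌊n^{1/4}⌋} (support DigitCurveExplicit + DigitCurveGivesTarget). Repair (2026-08-15, revs
3–6): the deciding theorem `closes : DigitCurveElusive → DigitCurveExplicit →
DigitCurveGivesTarget → ValiantsHypothesis` has LANDED (rev 3, planner g4; Raz's step
`Raz2010_elusive_curve_holds ℂ` and the hub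
`perFamily_mem_VNP_holds` / `mem_VP_ofFintype_iff_holds` are inlined, all proved Literature
theorems; cone: 0 unproved facts), so the
route decides VH from the crux DigitCurveElusive plus two bookkeeping supports. The refuted Sidon
MONOMIAL candidate ElusiveCandidate
(stmt-0340) and its satellites ElusiveRazCandidate / ElusiveThesis / HubPerNotVp / Assembly (rev-1
form) / Assembly2 (= Raz's step,
mis-kinded `assembly`) are LEGACY: no longer used by any argument of the route, they stay in the
file only until the operator clears
the gate deadlock route.multi-assembly (two assembly-kind items block every planner drop/restate;
OPERATOR-README attached to the route item).
Lean: `∃ (m : ℕ → ℕ) (f : ∀ n : ℕ, Fin (m n) → MvPolynomial (Fin 1) ℂ), (∀ c : ℕ, ∃ n₀ : ℕ, ∀ n ≥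
n₀, n ^ c ≤ m n) ∧ (∃ n₀ : ℕ, ∀ n ≥ n₀, ∀ i : Fin (m n), (f n i).totalDegree < 2 ^ n) ∧
Literature.Computability.AlgebraicComplexity.IsPolyDefinableMap (m := m) (σ := fun n => Fin n) (fun
n i => ∑ d ∈ (f n i).support, MvPolynomial.C (MvPolynomial.coeff d (f n i)) * ∏ j : Fin n, (if (d
0).testBit j then MvPolynomial.X j else 1)) ∧ (∃ n₀ : ℕ, ∀ n ≥ n₀, ∀ Γ : Fin (m n) → MvPolynomial
(Fin (m n - 1)) ℂ, (∀ i, (Γ i).totalDegree ≤ 2) → ¬ (Set.range (fun x : Fin 1 → ℂ => fun i : Fin (m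
n) => MvPolynomial.eval x (f n i)) ⊆ Set.range (fun y : Fin (m n - 1) → ℂ => fun i : Fin (m n) =>
MvPolynomial.eval y (Γ i))))`

## Assembly
Deciding theorem — LANDED at rev 3 (planner g4, certified native, `glue_ok`, 0 unproved cone facts):
`theorem closes : DigitCurveElusive → DigitCurveExplicit → DigitCurveGivesTarget →
ValiantsHypothesis` — obtain
X = ExplicitElusiveCurve from DigitCurveGivesTarget, then `(Raz2010_elusive_curve_holds
ℂ).not_isVPFamily_complex` (Raz2010 §1
result 1, proved in Literature/…/RazElusiveGeneralDischarge.lean) gives per ∉ VP_ℂ, and the hub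
(`perFamily_mem_VNP_holds ℂ`,
`mem_VP_ofFintype_iff_holds`, Valiant1979 / Burgisser2000) gives VP_ℂ ≠ VNP_ℂ; the route file
imports RazElusiveGeneralDischarge and
ValiantConjectureProofs for this (both sorry-free proof files). The item `Assembly` below is the
rev-1 LEGACY assembly in IsRazExplicit
vocabulary (provable by pure logic —
`Summit.ValiantsHypothesis.Elusive.valiantsHypothesis_of_elusive`, Theorems/ElusiveAssembly.lean,
has
exactly its type — but not the route's deciding chain); it cannot currently be restated or dropped
(route.multi-assembly, operator).

Rationale: WHY THIS LINE. Raz2010 turns VP ≠ VNP over ℂ into an explicit-construction problem of classical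
algebraic geometry — ONE explicit rational
curve of degree 2^{m^{o(1)}} outside every quadratically parametrised (m−1)-fold of ℂ^m — and the
reduction is PROVED in the
tree (Literature/Computability/AlgebraicComplexity/RazElusiveGeneralDischarge.lean), constants free,
so there is no
constant-elimination gap and no unproved fact in the cone. Two calibration theorems fix the design
(support SwallowedCurves):
every curve of coordinate degree < ⌊m/2⌋² is swallowed (additive 2-basis lift) and every MONOMIAL
curve in Raz's whole range
is swallowed by a ruled/monomial quadratic map built from one additive relation among the exponents
— the mechanism of the
in-tree refutation `Summit.ValiantsHypothesis.Elusive.not_elusive_candidate` of the Sidon moment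
curve (negatives index,
stmt-0340) and of Narayanan2026 Rem. 1 — so a candidate needs ≥ 2 monomials per coordinate and
degree ≫ m². The digit curve
takes two-term coordinates on a carry-free power-sum (B_h) exponent set: the base-T digits of a sum
of ≤ h exponents are the
power sums p_0, …, p_h of the summands, Newton's identities make h-fold sums unique, hence (engine
DigitCurveIndependent =
the degree-h analogue of GargMakamOliveiraWigderson2019 Prop. 9.6 and the univariate form of the
sumset-expansion motif of
Narayanan2026 Thm. 1) the monomials F^α, |α| ≤ h, are linearly independent and F eludes every Γ
whose image satisfies a
nonzero equation of degree ≤ h, and (DigitCurveDefeatsMonomialMaps) every monomial Γ of any degree.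
Imported areas: additive
combinatorics (B_h / Prouhet–Tarry–Escott-free exponent design), fewnomial identity theory and
Newton polygons for the lift
crux DigitCurveNoPolynomialLift (GMOW2019 §9's open 'polynomial lift' relaxation), Valiant–Raz
definability bookkeeping for
explicitness; no rank, flattening or depth-reduction measure is used. Versus the sibling route
BinomialElusive (same two-term
power-sum family at order (log₂ m)², valuation/peeling crux layer, opened 2026-08-15): this route
keeps order log₂ m (degree
2^{O(log³ m)}), the certified-engine + no-polynomial-lift decomposition, the explicitness item in
Def. 1.3 form and the
calibration theorems; either candidate proved elusive closes VH (BinomialElusive through the shared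
hub item PerNotVPToVH, this route through its inlined glue).

RANKED CRUXES. #0 ExplicitElusiveCurve (target) — Raz's explicit (m−1,2)-elusive curve family
exists, in the exact hypothesis bundle of `Raz2010_elusive_curve ℂ` (growth m(n) ≥ n^{ω(1)},
coordinate degrees < 2^n, poly(n)-definable multilinearisation inlined verbatim, eventual (m(n)−1,
2)-elusiveness with IsElusive unfolded). (why it might fail: It is Raz's open problem verbatim
(GMOW2019 §9: 'no progress since'); explicit curves may all be swallowed for a structural reason not
yet identified (cf. SwallowedCurves); or VP = VNP.) [Raz2010, GargMakamOliveiraWigderson2019,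
Narayanan2026, Landsberg2017]
#2 DigitCurveElusive (crux) — for all large m the digit curve of order h = ⌊log₂ m⌋, F_i =
x^{e(2i+1)} + x^{e(2i+2)} with e(v) = Σ_{k≤h} v^k (2m+2)^{(h+1)k}, is (m−1,2)-elusive: no quadratic
Γ : ℂ^{m−1} → ℂ^m has image containing F(ℂ). The bet of the route; already certified against every Γ
with an image equation of degree ≤ log₂ m (DigitCurveIndependent) and every monomial Γ
(DigitCurveDefeatsMonomialMaps). [difficulty: open-problem] (why it might fail: Only Γ with an image
equation of degree ≤ log₂ m are certified against; a structured Γ with eqdeg ≫ log m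
(k-special-coordinate ruled families, eqdeg ~2^k; lifts built on Prouhet–Tarry–Escott-type
coincidences among digit SUBSETS) may swallow it. Counting is no proof.) [Raz2010,
GargMakamOliveiraWigderson2019, Narayanan2026, Landsberg2017]
#3 DigitCurveNoPolynomialLift (crux) — necessary special case of DigitCurveElusive and GMOW2019 §9's
open relaxation: for all large m there is no quadratic Γ : ℂ^{m−1} → ℂ^m and no tuple of univariate
POLYNOMIALS y : Fin (m−1) → ℂ[x] with Γ∘y = F^{(⌊log₂ m⌋)}_m coordinatewise (a polynomial lift gives
Im F ⊆ Im Γ, so #2 ⇒ #3 and a refutation of #3 refutes #2 constructively). [difficulty: L] (why it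
might fail: A polynomial re-parametrisation with cancellations (non-monomial y) could exist:
fewnomial targets do not obviously force fewnomial lifts, and low-degree PTE-type coincidences among
SUBSETS of digits might be combinable. Open even for GMOW's toy curve (x^{3^i}).)
[GargMakamOliveiraWigderson2019, Raz2010, Narayanan2026]
#4 DigitCurveIndependent (crux) — the ENGINE (expected provable): for all h, m and P ∈
ℂ[Y_0..Y_{m−1}] of total degree ≤ h, P(F^{(h)}_m) = 0 in ℂ[x] ⇒ P = 0 — sums of ≤ h elements of the
carry-free power-sum exponent set are unique (digits = power sums, Newton), so the F^α with |α| ≤ h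
have disjoint supports and positive coefficients. Corollary used freely: F^{(h)} eludes every Γ (any
degree) whose image lies in a hypersurface of degree ≤ h. [difficulty: M] (why it might fail: Low
risk: an off-by-one in the carry bound (needs h·(2m)^h < (2m+2)^{h+1}) or in the length tag (digit_0
= number of summands) as typed; h = 0, 1 and m = 0 are degenerate but true. The B_h/Newton argument
is standard in characteristic 0.) [GargMakamOliveiraWigderson2019, Narayanan2026, Raz2010]
#9 DigitCurveExplicit (support) — Raz-explicitness (Def. 1.3, `IsPolyDefinableMap`) of the
multilinearised digit curve re-indexed n ↦ m(n) = 2^{⌊√⌊√n⌋⌋} (order s = Nat.log 2 (m n)); witness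
by Valiant's criterion (in-tree ValiantCriterion / CircuitArithmetization / BooleanGadgets
machinery) from a poly(n)-size Boolean circuit deciding the bits of e(2i+1), e(2i+2). Size L
bookkeeping, not a research obstruction. [difficulty: L] [Raz2010, Burgisser2000]
#9 DigitCurveGivesTarget (support) — index bookkeeping: with m(n) = 2^{⌊n^{1/4}⌋} and f n = the
digit curve of order Nat.log 2 (m n) (syntactically the family of DigitCurveExplicit), growth ∀ c,
eventually n^c ≤ m(n), degree e(2m) < 2^n for n ≥ 81, and elusiveness transported from
DigitCurveElusive's m₀ give ExplicitElusiveCurve. [difficulty: provable-now] [Raz2010]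
#9 DigitCurveDefeatsMonomialMaps (support) — for h ≥ 2, m ≥ 1 the digit curve eludes every MONOMIAL
map Γ (Γ_i = κ_i y^{μ_i}, any degree): a ℤ-relation among the m exponent rows gives Π F_i^{λ_i}
constant, and the two-term factors 1 + x^{c_i} with distinct gaps c_i (no c_j = 2c_i) are
multiplicatively independent (cyclotomic factorisation). h = 1 is false (e(1)+e(7) = e(3)+e(5)).
[difficulty: M] [GargMakamOliveiraWigderson2019, Narayanan2026]
#9 SwallowedCurves (support) — calibration no-go theorems: (A) every curve ℂ → ℂ^m with all
coordinate degrees < ⌊m/2⌋² is NOT (m−1,2)-elusive (additive 2-basis {0..k−1} ∪ {k,2k,…,(k−1)k},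
monomial lift); (B) for large m every monomial curve (x^{d_i}) with m³·d_i < 2^m is NOT
(m−1,2)-elusive (pigeonhole gives an additive coincidence realised by a ruled quadratic map;
generalises not_elusive_candidate). [difficulty: M] [Raz2010, Narayanan2026,
GargMakamOliveiraWigderson2019]
#9 ElusiveExists (support) — warm-up building the API (images of polynomial maps, constructibility,
dimension): for large m some integer-coefficient curve of degree ≤ m³ is (m−1,2)-elusive (Raz2010
§1.1 counting remark; Le2017 Thm 3.10 is the printed Zariski-density analogue). Not sufficient for
VH (explicitness missing) but identifies the equations a candidate must violate. [difficulty: M]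
[Raz2010, Le2017]
#9 HubPerNotVp (support) — LEGACY hub (stmt-ValiantsHypothesis-0317, shared with Depth4 / DetQP /
SymPencil / FreeEnergyLift / SummationBits; provable now:
Summit.ValiantsHypothesis.Hub.valiantsHypothesis_of_not_isVPFamily_per in Theorems/HubHub.lean,
candidate E21.lean attached): per ∉ VP_ℂ → bridge → per ∈ VNP → VP_ℂ ≠ VNP_ℂ. Redundant in THIS
route since the deciding theorem inlines the hub; kept only because structural edits are blocked
(route.multi-assembly). [difficulty: provable-now] [Valiant1979, Burgisser2000,
BurgisserClausenShokrollahi1997]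
#9 Assembly2 (support) — LEGACY-KINDED (stmt-ValiantsHypothesis-8429, ledger kind `assembly` by a
rev-2 filing accident; it is a SUPPORT step): Raz's proved implication instantiated,
ExplicitElusiveCurve ⇒ per is not a VP family over ℂ, by `(Raz2010_elusive_curve_holds
ℂ).not_isVPFamily_complex` (candidate proofs W18.lean / E20.lean attached; land in Theorems with the
Discharge import). True and worth landing; the deciding theorem re-proves it inline. To be re-kinded
support / dropped by the operator (route.multi-assembly). [difficulty: provable-now] [Raz2010]
#9 ElusiveThesis (support) — LEGACY (stmt-ValiantsHypothesis-0338, the rev-1 thesis in IsRazExplicit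
/ 2^{m^ε} vocabulary; superseded by the target ExplicitElusiveCurve in Raz's proved Def. 1.3
vocabulary; its IsRazExplicit → IsPolyDefinableMap bridge is unformalised). Not used by any
argument; to be dropped once structural edits are possible. [difficulty: open-problem] [Raz2010]
#9 ElusiveRazCandidate (support) — LEGACY (stmt-ValiantsHypothesis-0341): Raz's implication
specialised to the refuted Sidon moment curve — VACUOUSLY TRUE (its hypothesis is the refuted
ElusiveCandidate; `Summit.ValiantsHypothesis.Elusive.elusive_raz_candidate_vacuous` in
Theorems/ElusiveRefutations.lean proves it). To be dropped (or closed proved) once structural edits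
are possible. [difficulty: provable-now] [Raz2010]

TWO-LAYER PLAN. DigitCurveElusive ⇐ DigitCurveNoPolynomialLift → NoLaurentPuiseuxLift →
DigitCurveElusive (GMOW2019 Lemma 9.3 / Thm 1.21:
containment of the image forces an algebraic, hence Puiseux, lift at the places x = 0, ∞; k ≤ 3,
depth 1), to be filed only
after #3 or #4 closes. DigitCurveExplicit ⇐ BitCircuitForDigits → ValiantCriterionPackaging →
DigitCurveExplicit if a prover asks.

KILL CRITERIA. A refutation of DigitCurveElusive (an explicit swallowing Γ) names its mechanism: if
it exploits only the order (an additive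
relation of length between log₂ m and (log₂ m)² among the digits), pivot ONCE to order h = (log₂ m)²
— i.e. BinomialElusive's
candidate — and supersede this route by route-ValiantsHypothesis-BinomialElusive (shared decl); if
it swallows two-term
power-sum-digit curves at every order h = m^{o(1)} (a structural swallowing family for binomial
curves at s = m−1), close
`refuted:DigitCurveElusive` and record 'sparse curves die at s = m−1' as negative knowledge for both
routes. A refutation of
DigitCurveNoPolynomialLift refutes DigitCurveElusive constructively (same action). A theorem 'every
poly-definable curve family of
degree 2^{m^{o(1)}} is eventually swallowed' (an explicitness barrier) closes the line outright. VH
proved elsewhere, or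
BinomialCandidate proved (shared hub), moots it.

NOT DECOMPOSED YET. Γ whose image equations all have degree in (log₂ m, 2^{m−1}] and that are not
reached by polynomial lifts: Laurent/Puiseux lifts
at x = 0, ∞ (the Two-layer plan), ruled families with k special coordinates (eqdeg ~ 2^k),
torus-equivariant Γ; the
(s, r) = (⌊m^{9/10}⌋, 2) relaxation of Raz2010 (used by Narayanan2026 Thm. 1 for monomial curves at
exponential degree) for the
same curve, which would need its own explicitness/degree calibration; the verified O(n^{3/4})-bit
multiplier inside
DigitCurveExplicit. All are layer-2 children, filed when a crux closes.

CHEAPEST FALSIFIER. A kit/SMT search for a swallow at toy size: h = 2, m ∈ {4,…,8} (e(v) = 1 + vT +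
v²T², T = (2m+2)³), quadratic Γ with a POLYNOMIAL
or LAURENT-MONOMIAL lift y(x) whose coordinates have ≤ 3 terms and exponents ≤ e(2m), solving Γ∘y =
F coordinatewise — the
ansatz that killed the Sidon candidate (not_elusive_candidate, 3-vs-3 coincidence) and GMOW's
doubling-type curves
(Narayanan2026 Rem. 1). A hit at two consecutive m with a common pattern refutes
DigitCurveNoPolynomialLift / DigitCurveElusive.
Not run in this one-shot glue-repair session (no kit budget in the payload); five refuter passes on
2026-08-15 found no cheap swallow.

NUMBERS. Coordinate degree e(2m) ≤ (h+1)(2m)^h T^h with T = (2m+2)^{h+1}, h = ⌊log₂ m⌋: 2^{O(log³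
m)} = 2^{m^{o(1)}}, and < 2^n under
m(n) = 2^{⌊n^{1/4}⌋} for n ≥ 81 (Raz's range: degree < 2^n, m(n) ≥ n^{ω(1)}). Certified frontier:
all Γ with an image
equation of degree ≤ ⌊log₂ m⌋ and all monomial Γ; a generic quadratic image ℂ^{m−1} → ℂ^m is a
hypersurface of degree up to
2^{m−1}. Calibration: coordinate degree < ⌊m/2⌋² ⇒ swallowed; monomial curves with m³·d_i < 2^m ⇒
swallowed; the Sidon
moment curve is swallowed for every m ≥ 7 (negatives index). Prior art parameters: Narayanan2026
Thm. 1 proves (⌊m^{9/10}⌋, 2)-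
elusiveness of (z^{2^i}) at degree 2^{m−1} (monomial maps; lowering to 2^{m^{o(1)}} would give VH).
Items now: 15 in the file (ACTIVE: 1 target, 3 cruxes, 5 support = DigitCurveExplicit,
DigitCurveGivesTarget,
DigitCurveDefeatsMonomialMaps, SwallowedCurves, ElusiveExists; LEGACY: ElusiveCandidate (refuted),
ElusiveRazCandidate, ElusiveThesis, HubPerNotVp, Assembly,
Assembly2); deciding theorem over 3 of them (DigitCurveElusive, DigitCurveExplicit,
DigitCurveGivesTarget).

DEFINITION REQUESTS. None open: IsElusive, IsPolyDefinableMap, multilinearize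
(Literature.Computability.AlgebraicComplexity.Elusive / RazExplicit /
RazElusiveGeneral) have landed; the items inline IsElusive and multilinearize verbatim (defeq) ;
since rev 3 the route file also imports RazElusiveGeneralDischarge and
ValiantConjectureProofs for the inlined deciding theorem (both discharged: cone audit 0 unproved
named facts, 57 constants).

Novelty: Searches (2026-08-15): this repair read Narayanan2026 = arXiv:2607.15848 (`lit read arxiv:2607.15848
--grep 'elusive|binomial'`,
74 hits / 17 pp.; pp. 2–4, 11 read); inherited from rev 2 (same day): `lit search --hybrid 'elusive
functions polynomial mappings
explicit construction'` (Landsberg2017 §7.4.5, BCS1997, Arora–Barak only), zbMATH 'elusive functions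
arithmetic circuits' (Raz2010,
Shpilka–Yehudayoff, EfremenkoGargOliveiraWigderson2018), `lit galaxy search 'elusive polynomial
mapping' --star all` (Raz2010 only),
GMOW2019 arXiv:1904.04299 §9 pp. 24–25 re-read, and the 2026-08-13/14 sweep (Le2010 arXiv:1011.2887,
Le2017 arXiv:1302.3360,
KumarVolk2022).
Nearest prior art found: Raz2010 (poses X, proves X ⇒ per ∉ VP — in tree);
GargMakamOliveiraWigderson2019 §9 (Lemma 9.3 symbolic
criterion, Prop. 9.6 (m−1,1) from linear independence, Prop. 9.8 (x^{3^i}) vs MONOMIAL lifts,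
polynomial lifts left open);
Narayanan2026 arXiv:2607.15848 (Thm. 1: (z^{2^i}) is (⌊m^{9/10}⌋,2)-elusive by sumset expansion +
Chebotarev hitting sets; Rem. 1:
it is NOT (m−1,2)-elusive; Thm. 2: explicit expander exponent matrices ⇒ VH) — monomial curves/maps,
s = m^{9/10}, exponential
degree; Landsberg2017 §7.4.5 (equations for the union of quadratic images); sibling
route-ValiantsHypothesis-BinomialElusive
(same family, order (log₂ m)², peeling lemma).
Delta: two-term coordinates on a carry-free power-sum (B_h) exponent set at s = m−1 and
QUASI-POLYNOMIAL degree — inside Raz's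
range, where monomial curv  [refs: 2607.15848, 1904.04299, 1011.2887, 1302.3360, arxiv:2607.15848, Narayanan2026, Landsberg2017, Raz2010, EfremenkoGargOliveiraWigderson2018, Le2010, Le2017, KumarVolk2022, GargMakamOliveiraWigderson2019]

Barriers (technique_class: elusive-functions, explicit-construction, Bh-sets): - technique_class: elusive-functions, explicit-construction, Bh-sets
- Literature.Barriers.ValiantsHypothesis.AlgebraicNaturalProofs: ENGAGED and located
(ForbesShpilkaVolk2018 Thm 4 / Cor 5, conditional on succinct hitting sets;
ChatterjeeKumarRamyaSaptharishiTengse2020): the engine's certificates (P ≠ 0 of degree ≤ h vanishing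
on Im Γ) are algebraically natural of degree h, and finishing VH with the engine alone would need
image equations of degree m^{o(1)} for Raz's universal quadratic map, i.e. quasi-polynomial
distinguishers for the VP slice — so the engine certifiably stalls at eqdeg ≤ log₂ m ≪ 2^{m−1} and
cruxes #2/#3 must be won on NON-natural, curve-specific ground (two-term arithmetic, Newton polygons
at 0/∞, monodromy of lifts). It does not evade the barrier there; the bet is that the arithmetic of
ONE curve is not a large property.
- Literature.Barriers.ValiantsHypothesis.FullRankMultilinear: not engaged — no rank / flattening /
partial-derivative measure appears anywhere in the line.
- Literature.Barriers.ValiantsHypothesis.PartialDerivativesDetPerm: not engaged (same reason); the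
permanent enters only through Raz's proved reduction.
- Literature.Barriers.ValiantsHypothesis.DepthReductionChasm: not engaged — no depth reduction;
Raz's reduction is used as a proved black box at (s, r) = (m−1, 2).
- Negatives index: ElusiveCandidate (stmt-0340, the Sidon MONOMIAL moment curve, refuted by
Summit.ValiantsHypothesis.Elusive.ElusiveElusiveCandidate_refuted via the 3-vs-

History (route lifecycle, newest last):
- 2026-08-15T14:52:53Z · BROKEN — ElusiveCandidate (stmt-ValiantsHypothesis-0340, support) refuted by Summit.ValiantsHypothesis.Elusive.ElusiveElusiveCandidate_refuted @ 5a00f17dcecf (refuter-refute-pool-g41-40)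
- 2026-08-16T02:17:18Z · AUTO-CRUX: 1 conjecture-grade item(s) promoted to crux (ExplicitElusiveCurve) — refuter vetting / tiering apply (operator:999:1362873)
- 2026-08-16T05:54:04Z · CLOSED superseded — superseded:route-ValiantsHypothesis-BinomialElusive (planner-rbadge-ValiantsHypothesis-Elusive-e0ef0772-g3-0)

sub-problem: ValiantsHypothesis · status: closed(superseded) · opened planner-ValiantsHypothesis-Survey-0 2026-08-13T06:08:40Z · rev 11 · ledger route-ValiantsHypothesis-Elusive
GENERATED by the gate from the ledger (D-0016/17). Provers cite these decls: `theorem foo : Summit.ValiantsHypothesis.ValiantsHypothesis.Theses.Elusive.<Decl> := …` in Summits/ValiantsHypothesis/ValiantsHypothesis/Theorems/<Name>.lean.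
-/

namespace Summit.ValiantsHypothesis.ValiantsHypothesis.Theses.Elusive

open scoped BigOperators Topology Manifold Classical MeasureTheory ProbabilityTheory Matrix InnerProductSpace ComplexConjugate ContinuousMap
open Filter Set Function TopologicalSpace MeasureTheory

attribute [summit_statement] _root_.ValiantsHypothesis

open Literature.PNP

/-- item stmt-ValiantsHypothesis-8428 · target · rank 2 · closed · moot by None · by planner
why it might fail: It is Raz's open problem verbatim (GMOW2019 §9: elusiveness 'really hard', no explicit (m-1,2)-elusive curve known since 2010); every explicit low-complexity curve might be swallowed for a structural reason (cf. SwallowedCurves); or VP = VNP.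
sources: Raz2010 (doi:10.4086/toc.2010.v006a007) §1 result 1, Prop. 1.2, Def. 1.1, Def. 1.3, Literature.Computability.AlgebraicComplexity.Raz2010_elusive_curve_holds (RazElusiveGeneralDischarge.lean, proved), GargMakamOliveiraWigderson2019 (arXiv:1904.04299) §9 pp.24-25, Landsberg2017 §7.4.5
[support] FILED AS SUPPORT ONLY BECAUSE this repair unit lacks route-edit rights: it is the intended
TARGET (restate of ElusiveThesis/stmt-0338 with new decl name; edit.json prepared in the planner
folder). IsElusive is unfolded verbatim (defeq) to keep the route imports at RazExplicit only.
TARGET X in Raz's exact, PROVED vocabulary: ∃ m : ℕ→ℕ and curves f n : Fin (m n) → ℂ[x] with m(n) ≥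
n^{ω(1)} (∀ c, eventually n^c ≤ m n), coordinate degrees < 2^n eventually, the multilinearised
family (Raz2010 Prop. 1.2; `multilinearize` INLINED verbatim: Σ_{d∈supp} C(coeff d)·Π_{j<n}(if
bit_j(d 0) then X_j else 1), defeq) poly(n)-definable (`IsPolyDefinableMap`, Raz2010 Def. 1.3), and
eventually IsElusive (f n) (m n − 1) 2 (Def. 1.1). This is literally the hypothesis bundle of
`Literature.Computability.AlgebraicComplexity.Raz2010_elusive_curve ℂ`, whose `_holds` is in tree
(RazElusiveGeneralDischarge.lean), so X ⇒ ¬IsPComputable per ⇒ VH (Assembly). Replaces the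
IsRazExplicit/2^{m^ε} rendering of ElusiveThesis (that form needs an unformalised TM→circuit
bridge). Equivalent in content to Raz's open problem (abstract, §1.1 p.137 'The hard problem is to
construct f explicitly'). SOURCES: Raz2010 -/
@[route_item "route-ValiantsHypothesis-Elusive"]
def ExplicitElusiveCurve : Prop :=
  ∃ (m : ℕ → ℕ) (f : ∀ n : ℕ, Fin (m n) → MvPolynomial (Fin 1) ℂ), (∀ c : ℕ, ∃ n₀ : ℕ, ∀ n ≥ n₀, n ^ c ≤ m n) ∧ (∃ n₀ : ℕ, ∀ n ≥ n₀, ∀ i : Fin (m n), (f n i).totalDegree < 2 ^ n) ∧ Literature.Computability.AlgebraicComplexity.IsPolyDefinableMap (m := m) (σ := fun n => Fin n) (fun n i => ∑ d ∈ (f n i).support, MvPolynomial.C (MvPolynomial.coeff d (f n i)) * ∏ j : Fin n, (if (d 0).testBit j then MvPolynomial.X j else 1)) ∧ (∃ n₀ : ℕ, ∀ n ≥ n₀, ∀ Γ : Fin (m n) → MvPolynomial (Fin (m n - 1)) ℂ, (∀ i, (Γ i).totalDegree ≤ 2) → ¬ (Set.range (fun x : Fin 1 → ℂ => fun i : Fin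 (m n) => MvPolynomial.eval x (f n i)) ⊆ Set.range (fun y : Fin (m n - 1) → ℂ => fun i : Fin (m n) => MvPolynomial.eval y (Γ i))))

/-- item stmt-ValiantsHypothesis-8430 · crux · rank 2 · closed · moot by None · by planner
why it might fail: Only Γ with an image equation of degree ≤ log₂ m (and monomial Γ) are certified against; a structured Γ with eqdeg ≫ log m (k-special-coordinate ruled families, eqdeg ~2^k; lifts from Prouhet–Tarry–Escott-type coincidences among digit SUBSETS) may swallow it. Counting is no proof.
sources: Raz2010 (doi:10.4086/toc.2010.v006a007) Def. 1.1, §1.1, GargMakamOliveiraWigderson2019 (arXiv:1904.04299) §9 Lemma 9.3, Prop. 9.8, Narayanan2026 (arXiv:2607.15848) Thm. 1, Rem. 1, Landsberg2017 §7.4.5, negatives: Summit.ValiantsHypothesis.Elusive.ElusiveElusiveCandidate_refuted (stmt-0340, 3-vs-3 coincidence swallow)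
[crux] CRUX #2 (the bet), replacing the refuted Sidon monomial candidate (not_elusive_candidate, m ≥
7). Digit curve of order h: F^{(h)}_m : Fin m → ℂ[x], F_i = x^{e(2i+1)} + x^{e(2i+2)}, e(v) =
Σ_{k=0..h} v^k·T^k, T = (2m+2)^{h+1} (base-T digits of e(v) are the powers 1, v, v², …, v^h: a B_h
set of 2m exponents with length-tagged power-sum digits). (Sketch.lean of the planner has `def
digitExp/digitCurve`; all signatures unfold to them by Iff.rfl.) Claim: at order h = ⌊log₂ m⌋
(degree 2^{O(log³ m)} — inside Raz's range) the digit curve is (m−1,2)-elusive for all large m.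
Already certified by other items: it eludes every MONOMIAL Γ with arbitrary lifts
(DigitCurveDefeatsMonomialMaps) and, via DigitCurveIndependent, every quadratic Γ whose image has a
nonzero equation of degree ≤ log₂ m (incl. the ruled family (t·u_i, Q_a, Q_b) that killed the
predecessor: eliminating T = t² gives a degree-4 image equation). Design rationale: two terms per
coordinate (monomial curves are all swallowed: MonomialCurvesSwallowed), degree ≫ m²
(LowDegreeCurvesSwallowed), h = log₂ m so that Prouhet–Tarry–Escott coincidences of degree h inside
[1,2m] essentially vanish. A refutation must exhibit a swallow -/
@[route_item "route-ValiantsHypothesis-Elusive"]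
def DigitCurveElusive : Prop :=
  ∃ m₀ : ℕ, ∀ m ≥ m₀, ∀ Γ : Fin m → MvPolynomial (Fin (m - 1)) ℂ, (∀ i, (Γ i).totalDegree ≤ 2) → ¬ (Set.range (fun x : Fin 1 → ℂ => fun i : Fin m => MvPolynomial.eval x ((fun i : Fin m => (MvPolynomial.X 0 : MvPolynomial (Fin 1) ℂ) ^ (∑ k ∈ Finset.range (Nat.log 2 m + 1), (2 * (i : ℕ) + 1) ^ k * (2 * m + 2) ^ ((Nat.log 2 m + 1) * k)) + MvPolynomial.X 0 ^ (∑ k ∈ Finset.range (Nat.log 2 m + 1), (2 * (i : ℕ) + 2) ^ k * (2 * m + 2) ^ ((Nat.log 2 m + 1) * k))) i)) ⊆ Set.range (fun y : Fin (m - 1) → ℂ => fun i : Fin m => MvPolynomial.eval y (Γ i)))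

/-- item stmt-ValiantsHypothesis-8431 · crux · rank 3 · closed · moot by None · by planner
why it might fail: A polynomial re-parametrisation with cancellations (non-monomial y) could exist: fewnomial targets do not obviously force fewnomial lifts, and low-degree PTE-type coincidences among SUBSETS of digits might combine. Open even for GMOW's toy curve (x^{3^i}) (GMOW2019 p.25).
sources: GargMakamOliveiraWigderson2019 (arXiv:1904.04299) §9 p.25: 'We do not know how to extend it to arbitrary polynomials, let alone algebraic functions' (after Prop. 9.8), Raz2010 (doi:10.4086/toc.2010.v006a007) Def. 1.1, Narayanan2026 (arXiv:2607.15848) Rem. 1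
[crux] CRUX #3 — necessary special case of #2 and GMOW2019's open 'polynomial lift' relaxation (§9
p.25: 'We do not know how to extend it to arbitrary polynomials'): for large m there is NO quadratic
Γ : ℂ^{m−1} → ℂ^m and NO tuple of univariate POLYNOMIALS y : Fin (m−1) → ℂ[x] with Γ∘y = F^{(⌊log₂
m⌋)}_m coordinatewise (bind₁ y (Γ i) = F_i ∀ i). (A polynomial lift gives Im F ⊆ Im Γ, so #2 ⇒ #3; a
refutation of #3 refutes #2 constructively.) Technique owner: sparse-polynomial identities. WLOG
(GL_{m−1} on y) the y_j have distinct degrees; compare Newton polygons of Σ q_{jk} y_j y_k + Σ l_j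
y_j + c with the two-term targets x^{a_i}(1 + x^{c_i}) at x = ∞ AND x = 0; the B_h digit structure
forbids the m+2 independent graphic additive relations a 2-basis-type lift (y monomial) needs;
general y must produce massive cancellation. Counting: unknowns (m−1)(E+1) + m·C(m+1,2) vs ≈ m·e(2m)
equations, hopeless for generic data once E > m²/2. WHY IT MIGHT FAIL: A clever polynomial
re-parametrisation with cancellations (non-monomial y) could exist: fewnomial targets do not
obviously force fewnomial lifts, and PTE-type coincidences of low degree among SUBSETS of digits
might be combinable. Open ev -/
@[route_item "route-ValiantsHypothesis-Elusive"]
def DigitCurveNoPolynomialLift : Prop :=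
  ∃ m₀ : ℕ, ∀ m ≥ m₀, ∀ Γ : Fin m → MvPolynomial (Fin (m - 1)) ℂ, (∀ i, (Γ i).totalDegree ≤ 2) → ∀ y : Fin (m - 1) → MvPolynomial (Fin 1) ℂ, (fun i => MvPolynomial.bind₁ y (Γ i)) ≠ (fun i : Fin m => (MvPolynomial.X 0 : MvPolynomial (Fin 1) ℂ) ^ (∑ k ∈ Finset.range (Nat.log 2 m + 1), (2 * (i : ℕ) + 1) ^ k * (2 * m + 2) ^ ((Nat.log 2 m + 1) * k)) + MvPolynomial.X 0 ^ (∑ k ∈ Finset.range (Nat.log 2 m + 1), (2 * (i : ℕ) + 2) ^ k * (2 * m + 2) ^ ((Nat.log 2 m + 1) * k)))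

/-- item stmt-ValiantsHypothesis-0338 · support · rank 0 · closed · moot by None · by planner
why it might fail: Raz's open problem verbatim (GMOW2019 §9 'no progress'); in this rendering additionally the IsRazExplicit→IsPolyDefinableMap bridge (Valiant's criterion + TM simulation) is unformalised.
sources: Raz2010 (doi:10.4086/toc.2010.v006a007) abstract, §1.1 p.137, Def. 1.3, GargMakamOliveiraWigderson2019 (arXiv:1904.04299) §9
[needs_definition: IsElusive] Informal (needs defs
`Literature.Computability.AlgebraicComplexity.IsElusive (f : Fin m → MvPolynomial (Fin n) k) (s r :
ℕ) : Prop` := ∀ Γ : Fin m → MvPolynomial (Fin s) k with all totalDegree ≤ r, range(eval f) ⊄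
range(eval Γ) [Raz2010 Def 1.1]; and `IsRazExplicit` = coefficient/exponent data computable in time
polynomial in index bit-length [Raz2010 §1]). Thesis: there is a Raz-explicit family f_m : ℂ → ℂ^m
of univariate polynomial maps of degree ≤ 2^(m^{o(1)}) that is (m-1, 2)-elusive for all large m. By
[Raz2010, abstract/§1 corollary] this implies per_n has no polynomial-size circuits over ℂ
(constants free) ⇒ VH via the hub. Concrete typed candidate: elusive_candidate. -/
@[route_item "route-ValiantsHypothesis-Elusive"]
def ElusiveThesis : Prop :=
  ∃ f : ∀ m : ℕ, Fin m → Polynomial ℤ, Literature.Computability.AlgebraicComplexity.IsRazExplicit f ∧ (∀ ε : ℝ, 0 < ε → ∃ m₀ : ℕ, ∀ m ≥ m₀, ∀ i : Fin m, ((f m i).natDegree : ℝ) ≤ (2 : ℝ) ^ ((m : ℝ) ^ ε)) ∧ (∃ m₀ : ℕ, ∀ m ≥ m₀, ∀ Γ : Fin m → MvPolynomial (Fin (m - 1)) ℂ, (∀ i, (Γ i).totalDegree ≤ 2) → ¬ (Set.range (fun x : ℂ => fun i : Fin m => Polynomial.aeval x (f m i)) ⊆ Set.range (fun y : Fin (m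 - 1) → ℂ => fun i : Fin m => MvPolynomial.eval y (Γ i))))

/-- item stmt-ValiantsHypothesis-0317 · support · rank 1 · open · by planner
sources: Valiant1979; BurgisserClausenShokrollahi1997, Prop (21.15) p.575 (per ∈ VNP; held, reground 2026-08-14), Summit.ValiantsHypothesis.Hub.valiantsHypothesis_of_not_isVPFamily_per (Summits/ValiantsHypothesis/ValiantsHypothesis/Theorems/HubHub.lean:17)
Hub lemma shared by all permanent-based routes: if the permanent family over ℂ is not a VP family
then VP ℂ ≠ VNP ℂ, given the renaming bridge (mem_VP_ofFintype_iff instance) and per ∈ VNP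
[Valiant1979; Burgisser2000 Thm 2.10]. Trivial bookkeeping; land once in
Summits/ValiantsHypothesis/Theorems/Hub/. -/
@[route_item "route-ValiantsHypothesis-Elusive"]
def HubPerNotVp : Prop :=
  ¬ Literature.Computability.AlgebraicComplexity.IsVPFamily (fun n => Literature.Computability.AlgebraicComplexity.perPoly (Fin n) ℂ) → (Literature.Computability.AlgebraicComplexity.perFamily ℂ ∈ Literature.Computability.AlgebraicComplexity.VP ℂ ↔ Literature.Computability.AlgebraicComplexity.IsVPFamily (fun n => Literature.Computability.AlgebraicComplexity.perPoly (Fin n) ℂ)) → Literature.Computability.AlgebraicComplexity.perFamily_mem_VNP ℂ → ValiantsHypothesis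

/-- item stmt-ValiantsHypothesis-0340 · support · rank 2 · closed · refuted by Summit.ValiantsHypothesis.Elusive.ElusiveElusiveCandidate_refuted @ 5a00f17dcecf (refuter) · by planner
why it might fail: It IS false for every m ≥ 7 — refuted in tree (not_elusive_candidate): the ruled quadratic map (u2·u6, u4·u5, t·u2, …, t·u_(m-1)) swallows the curve via the 3-vs-3 exponent coincidence d0+d4+d5 = d1+d2+d6, which the Sidon (B2) condition does not exclude. Awaits close as refuted.
sources: Summit.ValiantsHypothesis.Elusive.not_elusive_candidate (Summits/ValiantsHypothesis/ValiantsHypothesis/Theorems/ElusiveRefutations.lean:99; accepted p3474/p3479/p3494), Summit.ValiantsHypothesis.Elusive.exists_quadratic_swallowing_momentCurve (Theorems/ElusiveRefutations.lean:46, m ≥ 7), Raz2010, Def 1.1 ((s,r)-elusive) and abstract (the (m-1,2) curve question), GargMakamOliveiraWigderson2019 (arXiv:1904.04299) §9 Prop 9.8 / Lemma 9.3: nearest printed analogue (monomial curve, elusive only against monomial maps)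
Concrete typed candidate for X_Elusive: d_i = (i+1)(2m²+1) + (i+1)² for i < m is a Sidon (B₂) set
(pairwise sums distinct), so no coordinate is a product of two others and graph-type quadratic maps
fail; degree O(m³) > m² is in the range where a dimension count (≈ m³/2 parameters for quadratic
maps Γ : ℂ^{m-1} → ℂ^m vs ≈ m·D for degree-D curves) makes generic curves elusive. Trivially
Raz-explicit. Refutation is informative: it names the quadratic family swallowing Sidon monomial
curves (torus-equivariant Γ are the first suspects). Sources: Raz2010 §1. -/
@[route_item "route-ValiantsHypothesis-Elusive"]
def ElusiveCandidate : Prop :=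
  ∃ m₀ : ℕ, ∀ m ≥ m₀, ∀ Γ : Fin m → MvPolynomial (Fin (m - 1)) ℂ, (∀ i, (Γ i).totalDegree ≤ 2) → ¬ (Set.range (fun x : ℂ => fun i : Fin m => x ^ (((i : ℕ) + 1) * (2 * m ^ 2 + 1) + ((i : ℕ) + 1) ^ 2)) ⊆ Set.range (fun y : Fin (m - 1) → ℂ => fun i : Fin m => MvPolynomial.eval y (Γ i)))

/-- item stmt-ValiantsHypothesis-0341 · support · rank 3 · closed · moot by None · by planner
sources: Raz2010, abstract and §1 (Cor 1.14 = Cor 5.8), Prop 1.2, remark after Def 1.3, Literature.Computability.AlgebraicComplexity.raz_elusive_momentCurve (Literature/Computability/AlgebraicComplexity/RazElusive.lean), Summit.ValiantsHypothesis.Elusive.elusive_raz_candidate_vacuous (Theorems/ElusiveRefutations.lean:137)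
Raz's implication [Raz2010, abstract and §1: 'any explicit f : ℂ → ℂ^m, (m-1,2)-elusive, of degree
up to 2^(m^{o(1)}), implies super-polynomial lower bounds for the permanent over ℂ'] specialised to
the Sidon moment curve (degree O(m³), monomial coordinates, hence explicit in every sense used
there). Grounder: confirm the explicitness notion of Raz2010 §1.2/§5 covers this f and that
'super-polynomial lower bound for per' there means ¬IsPComputable with free constants (it does:
general arithmetic circuits over ℂ). -/
@[route_item "route-ValiantsHypothesis-Elusive"]
def ElusiveRazCandidate : Prop :=
  (∃ m₀ : ℕ, ∀ m ≥ m₀, ∀ Γ : Fin m → MvPolynomial (Fin (m - 1)) ℂ, (∀ i, (Γ i).totalDegree ≤ 2) → ¬ (Set.range (fun x : ℂ => fun i : Fin m => x ^ (((i : ℕ) + 1) * (2 * m ^ 2 + 1) + ((i : ℕ) + 1) ^ 2)) ⊆ Set.range (fun y : Fin (m - 1) → ℂ => fun i : Fin m => MvPolynomial.eval y (Γ i)))) → ¬ Literature.Computability.AlgebraicComplexity.IsVPFamily (fun n => Literature.Computability.AlgebraicComplexity.perPoly (Fin n) ℂ)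

/-- item stmt-ValiantsHypothesis-0342 · support · rank 4 · closed · moot by None · by planner
sources: Raz2010, §1.1 (PDF p.3) remark: existence of NON-explicit elusive polynomial maps is not hard; 'The hard problem is to construct f explicitly' (grounder: no numbered Prop in Raz2010 asserts it), Le2017 (arXiv:1302.3360), Thm 3.10: Zariski-density of (weakly) elusive homogeneous maps for suitable parameters — printed analogue, Mathlib: Chevalley constructibility (Mathlib.RingTheory.Spectrum.Prime.Chevalley) for the constructible-image step
Warm-up that builds the API (images of polynomial maps, constructibility, dimension): the
non-elusive curves of degree D form a constructible family of dimension ≤ m·C(m+1,2) +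
(m-1)(D/2+1)-ish, less than the ≈ m(D+1) dimensions of all parametrised degree-D curves once D > m²,
so a Zariski-general — in particular some integer-coefficient — curve of degree m³ is
(m-1,2)-elusive [Raz2010 §1, counting argument, Prop. 3.x]. Expected provable; not sufficient for VH
(explicitness missing) but its proof identifies the equations a candidate must violate. -/
@[route_item "route-ValiantsHypothesis-Elusive"]
def ElusiveExists : Prop :=
  ∃ m₀ : ℕ, ∀ m ≥ m₀, ∃ f : Fin m → Polynomial ℤ, (∀ i, (f i).natDegree ≤ m ^ 3) ∧ ∀ Γ : Fin m → MvPolynomial (Fin (m - 1)) ℂ, (∀ i, (Γ i).totalDegree ≤ 2) → ¬ (Set.range (fun x : ℂ => fun i : Fin m => Polynomial.aeval x (f i)) ⊆ Set.range (fun y : Fin (m - 1) → ℂ => fun i : Fin m => MvPolynomial.eval y (Γ i)))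

/-- item stmt-ValiantsHypothesis-8432 · support · rank 4 · closed · moot by None · by planner
why it might fail: Low risk: an off-by-one in the carry bound (needs h·(2m)^h < (2m+2)^{h+1}) or in the length tag (digit_0 = number of summands) as typed; h = 0, 1 and m = 0 are degenerate but true. The B_h/Newton argument is standard in characteristic 0.
sources: GargMakamOliveiraWigderson2019, Narayanan2026, Raz2010
[crux] CRUX #4 — the ENGINE (expected provable; degree-h analogue of GMOW2019 Prop. 9.6; fixes the
certified frontier). Digit curve of order h: F^{(h)}_m : Fin m → ℂ[x], F_i = x^{e(2i+1)} +
x^{e(2i+2)}, e(v) = Σ_{k=0..h} v^k·T^k, T = (2m+2)^{h+1} (base-T digits of e(v) are the powers 1, v,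
v², …, v^h: a B_h set of 2m exponents with length-tagged power-sum digits). Claim: for all h, m and
P ∈ ℂ[Y_0..Y_{m−1}] of total degree ≤ h, P(F^{(h)}_m) = 0 (as a polynomial in x;
`MvPolynomial.bind₁`) ⇒ P = 0. Proof sketch: a sum of L ≤ h elements of E = {e(v) : 1 ≤ v ≤ 2m} has
base-T digit_k = Σ_l v_l^k ≤ h(2m)^h < T = (2m+2)^{h+1} (Bernoulli), digit_0 = L; power sums
p_1..p_h of ≤ h positive integers determine the multiset (Newton identities, char 0) ⇒ distinct
multisets of ≤ h exponents have distinct sums ⇒ the expansions of the monomials F^α (|α| ≤ h) have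
pairwise DISJOINT supports with positive multinomial coefficients ⇒ linear independence. COROLLARY
(use freely): if P ≠ 0, deg P ≤ h and P vanishes on Im Γ (any map Γ whatsoever), then Im F ⊄ Im Γ —
so F^{(h)} eludes every quadratic Γ whose image lies in a hypersurface of degree ≤ h. WHY IT MIGHT
FAIL: Low risk: an off-by-one in the carry -/
@[route_item "route-ValiantsHypothesis-Elusive"]
def DigitCurveIndependent : Prop :=
  ∀ (h m : ℕ) (P : MvPolynomial (Fin m) ℂ), P.totalDegree ≤ h → MvPolynomial.bind₁ (fun i : Fin m => (MvPolynomial.X 0 : MvPolynomial (Fin 1) ℂ) ^ (∑ k ∈ Finset.range (h + 1), (2 * (i : ℕ) + 1) ^ k * (2 * m + 2) ^ ((h + 1) * k)) + MvPolynomial.X 0 ^ (∑ k ∈ Finset.range (h + 1), (2 * (i : ℕ) + 2) ^ k * (2 * m + 2) ^ ((h + 1) * k))) P = 0 → P = 0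

/-- item stmt-ValiantsHypothesis-8433 · support · rank 5 · closed · moot by None · by planner
[support] SUPPORT (size L) — Raz-explicitness (Def. 1.3, `IsPolyDefinableMap`) of the re-indexed
multilinearised digit curve: n ↦ m(n) = 2^s, s = ⌊√⌊√n⌋⌋ (so Nat.log 2 (m n) = s = h), f n i =
multilinearize n (F^{(s)}_{2^s})_i (inlined, defeq). Witness: ℓ = n + (gate count), g(x,e,w) =
[V_a(e,w) + V_b(e,w)] · Π_{j<n}(e_j X_j + 1 − e_j) where V_a (resp. V_b) is the transcript
arithmetisation of a poly(n)-size B₂-circuit deciding 'e = low n bits of e(2i+1)' (resp. e(2i+2)), i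
read from the ⌈log₂ m⌉ = s bits w; then Σ_e g = multilinMonomial n (a_i) + multilinMonomial n (b_i).
Machinery in tree: ValiantCriterion.witness/circuitSum/boolSum_witness (Bürgisser Prop. 2.20
pattern), CircuitArithmetization.arith, BooleanGadgets.selProd, Complexity/AdderBlocks;
RazElusiveGeneralDefinable.lean is the worked example of a w-block (index-bit) Boolean sum. Needs a
verified schoolbook multiplier on O(s³)=O(n^{3/4})-bit numbers for v^k·T^k. SOURCES: Raz2010
(doi:10.4086/toc.2010.v006a007) Def. 1.3 and the remark after it; Prop. 1.2; Burgisser2000 Prop.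
2.20 (Valiant's criterion) =
Literature.Computability.AlgebraicComplexity.ValiantCriterion.isVNPFamily_circuitSum -/
@[route_item "route-ValiantsHypothesis-Elusive"]
def DigitCurveExplicit : Prop :=
  Literature.Computability.AlgebraicComplexity.IsPolyDefinableMap (m := fun n => 2 ^ Nat.sqrt (Nat.sqrt n)) (σ := fun n => Fin n) (fun n (i : Fin (2 ^ Nat.sqrt (Nat.sqrt n))) => ∑ d ∈ ((MvPolynomial.X 0 : MvPolynomial (Fin 1) ℂ) ^ (∑ k ∈ Finset.range (Nat.log 2 (2 ^ Nat.sqrt (Nat.sqrt n)) + 1), (2 * (i : ℕ) + 1) ^ k * (2 * 2 ^ Nat.sqrt (Nat.sqrt n) + 2) ^ ((Nat.log 2 (2 ^ Nat.sqrt (Nat.sqrt n)) + 1) * k)) + MvPolynomial.X 0 ^ (∑ k ∈ Finset.range (Nat.log 2 (2 ^ Nat.sqrt (Nat.sqrt n)) + 1), (2 * (i : ℕ) + 2) ^ k * (2 * 2 ^ Nat.sqrt (Nat.sqrt n) + 2) ^ ((Nat.log 2 (2 ^ Nat.sqrt (Nat.sqrt n)) + 1) * k))).support, MvPolynomial.C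 (MvPolynomial.coeff d ((MvPolynomial.X 0 : MvPolynomial (Fin 1) ℂ) ^ (∑ k ∈ Finset.range (Nat.log 2 (2 ^ Nat.sqrt (Nat.sqrt n)) + 1), (2 * (i : ℕ) + 1) ^ k * (2 * 2 ^ Nat.sqrt (Nat.sqrt n) + 2) ^ ((Nat.log 2 (2 ^ Nat.sqrt (Nat.sqrt n)) + 1) * k)) + MvPolynomial.X 0 ^ (∑ k ∈ Finset.range (Nat.log 2 (2 ^ Nat.sqrt (Nat.sqrt n)) + 1), (2 * (i : ℕ) + 2) ^ k * (2 * 2 ^ Nat.sqrt (Nat.sqrt n) + 2) ^ ((Nat.log 2 (2 ^ Nat.sqrt (Nat.sqrt n)) + 1) * k)))) * ∏ j : Fin n, (if (d 0).testBit j then MvPolynomial.X j else 1))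

/-- item stmt-ValiantsHypothesis-8434 · support · rank 6 · closed · moot by None · by planner
[support] SUPPORT (expected provable, elementary) — for h ≥ 2, m ≥ 1 the digit curve eludes every
MONOMIAL map Γ : ℂ^{m−1} → ℂ^m (Γ_i = κ_i·y^{μ_i}, ANY degree, κ_i = 0 allowed). Proof sketch: the m
exponent rows μ_i ∈ ℚ^{m−1} are linearly dependent ⇒ λ ∈ ℤ^m∖0 with Σ λ_i μ_i = 0. If Im F ⊆ Im Γ
then for the cofinitely many x with all F_i(x) ≠ 0 pick y with Γ(y) = F(x): all κ_i ≠ 0 and the used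
y_v ≠ 0, so Π_i F_i(x)^{λ_i} = Π κ_i^{λ_i} =: K; hence Π F_i^{λ_i} = K as rational functions. Write
F_i = x^{a_i}(1 + x^{c_i}), c_i = e(2i+2) − e(2i+1) with base-T digits (0, 1, 4i+3, …): the c_i are
distinct (h ≥ 2) and no c_j = 2c_i (digit_1 of 2c_i is 2). Lowest order at 0 gives K = 1, Σλ_i a_i =
0 and Π(1 + x^{c_i})^{λ_i} = 1; using 1 + x^c = (1 − x^{2c})/(1 − x^c) and multiplicative
independence of {1 − x^n} (cyclotomic factorisation), the largest c_i with λ_i ≠ 0 gives a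
contradiction. m = 1: Γ is constant, F_0 is not. (h = 1 is FALSE: e(1)+e(7) = e(3)+e(5) gives F_0F_3
= F_1F_2.) Incomparable with GMOW2019 Prop. 9.8 (there Γ general, lifts monomial with exponents ≥
0). SOURCES: GargMakamOliveiraWigderson2019 (arXiv:1904.04299) §9 pp.24-25 Prop. 9.8;
Summit.ValiantsHypothesis.Elusive.n -/
@[route_item "route-ValiantsHypothesis-Elusive"]
def DigitCurveDefeatsMonomialMaps : Prop :=
  ∀ (h m : ℕ), 2 ≤ h → 1 ≤ m → ∀ Γ : Fin m → MvPolynomial (Fin (m - 1)) ℂ, (∀ i, ∃ (μ : Fin (m - 1) →₀ ℕ) (κ : ℂ), Γ i = MvPolynomial.monomial μ κ) → ¬ (Set.range (fun x : Fin 1 → ℂ => fun i : Fin m => MvPolynomial.eval x ((fun i : Fin m => (MvPolynomial.X 0 : MvPolynomial (Fin 1) ℂ) ^ (∑ k ∈ Finset.range (h + 1), (2 * (i : ℕ) + 1) ^ k * (2 * m + 2) ^ ((h + 1) * k)) + MvPolynomial.X 0 ^ (∑ k ∈ Finset.range (h + 1), (2 * (i : ℕ) + 2) ^ k * (2 * m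 + 2) ^ ((h + 1) * k))) i)) ⊆ Set.range (fun y : Fin (m - 1) → ℂ => fun i : Fin m => MvPolynomial.eval y (Γ i)))

/-- item stmt-ValiantsHypothesis-8379 · support · rank 8 · closed · moot by None · by planner
[support] Calibration no-go theorems (two conjuncts, both expected provable; the second generalises
the accepted refutation not_elusive_candidate and is the recommended warm-up). (A)
LowDegreeCurvesSwallowed: EVERY curve f : ℂ → ℂ^m with all coordinate degrees < ⌊m/2⌋² is NOT
(m−1,2)-elusive. Proof: k = ⌊m/2⌋; the additive 2-basis B = {0,1,…,k−1} ∪ {k,2k,…,(k−1)k} has |B| =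
2k−1 ≤ m−1 and every n < k² is n = qk + r (q,r < k), so x^n = y_{qk}·y_r (or y_r·y_0) along the
monomial lift y_b(x) = x^b (b ∈ B; unused variables arbitrary); rewriting each f_i this way gives a
quadratic Γ with Im f ⊆ Γ(Im y) ⊆ Im Γ. m ≤ 3: constant curves, constant Γ; m = 0,1 vacuous.
Consequence for the route: explicit candidates need degree ≫ m² (the digit curve has 2^{Θ(log³ m)});
the low-degree binomial curve x^{i+1} + x^{m+2i+2}, which DOES defeat all monomial maps, is
swallowed. (B) MonomialCurvesSwallowed: for m ≥ m₀, every monomial curve x ↦ (x^{d_i})_{i<m} with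
m³·d_i < 2^m is NOT (m−1,2)-elusive — monomial curves are useless in Raz's whole range 2^{m^{o(1)}}.
Proof sketch: repeated exponents ⇒ hyperplane; some d_i = 0 ⇒ constant coordinate; else with p =
⌊(m−1)/2⌋, C(m,p) > p·max d forces two p-subs -/
@[route_item "route-ValiantsHypothesis-Elusive"]
def SwallowedCurves : Prop :=
  (∀ (m : ℕ) (f : Fin m → MvPolynomial (Fin 1) ℂ), (∀ i, (f i).totalDegree < (m / 2) ^ 2) → ¬ (∀ Γ : Fin m → MvPolynomial (Fin (m - 1)) ℂ, (∀ i, (Γ i).totalDegree ≤ 2) → ¬ (Set.range (fun x : Fin 1 → ℂ => fun i : Fin m => MvPolynomial.eval x (f i)) ⊆ Set.range (fun y : Fin (m - 1) → ℂ => fun i : Fin m => MvPolynomial.eval y (Γ i))))) ∧ (∃ m₀ : ℕ, ∀ m ≥ m₀, ∀ d : Fin m → ℕ, (∀ i, m ^ 3 * d i < 2 ^ m) → ¬ (∀ Γ : Fin m → MvPolynomial (Fin (m - 1)) ℂ, (∀ i, (Γ i).totalDegree ≤ 2) → ¬ (Set.range (fun x : Fin 1 → ℂ => fun i : Fin m =>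 MvPolynomial.eval x ((fun i : Fin m => (MvPolynomial.X 0 : MvPolynomial (Fin 1) ℂ) ^ d i) i)) ⊆ Set.range (fun y : Fin (m - 1) → ℂ => fun i : Fin m => MvPolynomial.eval y (Γ i)))))

/-- item stmt-ValiantsHypothesis-8435 · support · rank 9 · closed · moot by None · by planner
[support] GLUE (support): DigitCurveElusive → DigitCurveExplicit → ExplicitElusiveCurve. Take m n :=
2^{⌊√⌊√n⌋⌋} and f n := the digit curve of order Nat.log 2 (m n) (= s) at m n (syntactically the
family of DigitCurveExplicit, so the explicitness conjunct is the hypothesis and the target's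
inlined multilinearisation matches by rfl). Growth: ∀ c, eventually n^c ≤ 2^{⌊n^{1/4}⌋}. Degree:
totalDegree (X^a + X^b) = b ≤ e(2m) ≤ (s+1)(2m·T)^s ≤ 2^{s³+4s²+4s} < 2^{s⁴} ≤ 2^n for s ≥ 3 (n ≥
81), using m = 2^s, T = (2m+2)^{s+1} ≤ 2^{(s+2)(s+1)}. Elusiveness: from DigitCurveElusive's m₀ pick
n₀ with 2^{⌊n₀^{1/4}⌋} ≥ m₀. SOURCES: Raz2010 (doi:10.4086/toc.2010.v006a007) §1 (parameter regime m
≥ n^{ω(1)}) -/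
@[route_item "route-ValiantsHypothesis-Elusive"]
def DigitCurveGivesTarget : Prop :=
  DigitCurveElusive → DigitCurveExplicit → ExplicitElusiveCurve

/-- item stmt-ValiantsHypothesis-0339 · assembly · rank 1 · closed · moot by None · by planner
[needs_definition: IsElusive] Informal until IsElusive/IsRazExplicit land: [Raz2010 §1, main
corollary for (s,r) = (m-1,2), n = 1, degree ≤ 2^(m^{o(1)})]: X_Elusive ⇒ ¬ IsVPFamily (fun n =>
perPoly (Fin n) ℂ); then hub_per_not_vp gives ValiantsHypothesis. The typed instance for the
concrete candidate is elusive_raz_candidate. -/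
@[route_item "route-ValiantsHypothesis-Elusive"]
def Assembly : Prop :=
  (∀ f : ∀ m : ℕ, Fin m → Polynomial ℤ, Literature.Computability.AlgebraicComplexity.IsRazExplicit f → (∀ ε : ℝ, 0 < ε → ∃ m₀ : ℕ, ∀ m ≥ m₀, ∀ i : Fin m, ((f m i).natDegree : ℝ) ≤ (2 : ℝ) ^ ((m : ℝ) ^ ε)) → (∃ m₀ : ℕ, ∀ m ≥ m₀, ∀ Γ : Fin m → MvPolynomial (Fin (m - 1)) ℂ, (∀ i, (Γ i).totalDegree ≤ 2) → ¬ (Set.range (fun x : ℂ => fun i : Fin m => Polynomial.aeval x (f m i)) ⊆ Set.range (fun y : Fin (m - 1) → ℂ => fun i : Fin m => MvPolynomial.eval y (Γ i)))) → ¬ Literature.Computability.AlgebraicComplexity.IsVPFamily (fun n => Literature.Computability.AlgebraicComplexity.perPoly (Fin n) ℂ)) → (∃ f : ∀ m : ℕ, Fin m → Polynomial ℤ, Literature.Computability.AlgebraicComplexity.IsRazExplicit f ∧ (∀ ε : ℝ, 0 < ε → ∃ m₀ : ℕ, ∀ m ≥ m₀, ∀ i : Fin m, ((f m i).natDegree :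 ℝ) ≤ (2 : ℝ) ^ ((m : ℝ) ^ ε)) ∧ (∃ m₀ : ℕ, ∀ m ≥ m₀, ∀ Γ : Fin m → MvPolynomial (Fin (m - 1)) ℂ, (∀ i, (Γ i).totalDegree ≤ 2) → ¬ (Set.range (fun x : ℂ => fun i : Fin m => Polynomial.aeval x (f m i)) ⊆ Set.range (fun y : Fin (m - 1) → ℂ => fun i : Fin m => MvPolynomial.eval y (Γ i))))) → (Literature.Computability.AlgebraicComplexity.perFamily ℂ ∈ Literature.Computability.AlgebraicComplexity.VP ℂ ↔ Literature.Computability.AlgebraicComplexity.IsVPFamily (fun n => Literature.Computability.AlgebraicComplexity.perPoly (Fin n) ℂ)) → Literature.Computability.AlgebraicComplexity.perFamily_mem_VNP ℂ → ValiantsHypothesis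

/-- item stmt-ValiantsHypothesis-8429 · assembly · rank 3 · closed · moot by None · by planner
[support] FILED AS SUPPORT: the intended new ASSEMBLY (restate of Assembly/stmt-0339), provable
today (script in the planner's Sketch3.lean, rc 0). Statement: ASSEMBLY (provable today; script rc 0
in the planner's Sketch.lean): from X = ExplicitElusiveCurve obtain (m, f, growth, degree, explicit,
elusive); `(Raz2010_elusive_curve_holds ℂ).not_isVPFamily_complex` gives ¬IsVPFamily (fun N =>
perPoly (Fin N) ℂ); with the renaming bridge `perFamily ℂ ∈ VP ℂ ↔ IsVPFamily …` and
`perFamily_mem_VNP ℂ` (both as hypotheses, as in HubPerNotVp / HubHub.lean) conclude VP ℂ ≠ VNP ℂ =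
ValiantsHypothesis. Needs `import
Literature.Computability.AlgebraicComplexity.RazElusiveGeneralDischarge` in the Theorems file (NOT
in the route file: keeps the route cone free of raz_elusive_curve / raz_elusive_momentCurve). -/
@[route_item "route-ValiantsHypothesis-Elusive"]
def Assembly2 : Prop :=
  ExplicitElusiveCurve → ¬ Literature.Computability.AlgebraicComplexity.IsVPFamily (fun n => Literature.Computability.AlgebraicComplexity.perPoly (Fin n) ℂ)

end Summit.ValiantsHypothesis.ValiantsHypothesis.Theses.Elusive
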